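import Mathlib
import HarnessLib
import Summits.ValiantsHypothesis.ValiantsHypothesis.Theorems.LacunarySymmetroidMatrixDescartesProductPlusOneSplitSignedKWindowMirror

/-!
# ValiantsHypothesis / LacunarySymmetroid — crux `MatrixDescartes` (stmt-ValiantsHypothesis-18050, V1),
# LINE (A) «product_plus_one»: the PIVOT WINDOW LAW — every `K`, every coupling, every support

One statement containing ALL the type-β window laws of the line: the `K = 3` bottom-coupling AB laws ✓
`euler_roots_Icc_le_one_of_letterSum_one_pos` / `…_two_neg` (`…ProductPlusOneABWindow`), the `K = 3` middle-coupling laws ✓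
`eulerNumeratorMiddle_roots_Icc_le_one_of_letterSumTwo_neg` / `…Zero_neg` (`…ABWindowMiddle`), and this hand's every-`K` near-end laws ✓
`eulerNumeratorK_roots_Icc_le_one_of_upperSums_neg` / `…_of_lowerSums_neg` (`…SplitSignedKWindow`, `…Mirror`).

Setting: rows `f_j = Σ_l C a_{jl} X^{d_l}` (ANY `K`, ANY support `d`), coupled letter `l₀`, SPLIT-SIGNED rows (letters below the coupled
exponent `≥ 0`, above `≤ 0`), a window `[u,v] ⊂ (0,∞)` on which every row keeps a constant sign, and the LETTER-FRACTION SUMS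
`A_l(x) = Σ_j a_{jl}·x^{d_{l₀}}/f_j(x)` (isotone for lower letters, antitone for upper letters, ✓ `inv_row_monotone_of_splitSigned`).  Off the
poles `Σ_j B_j/f_j = Σ_l (d_l − d_{l₀})·A_l(x)·x^{d_l − d_{l₀}}`.  A letter `l` is AHEAD-DOMINATED at `x` when `A_l(x)` has the sign an ahead row
gives it (`A_l > 0` for a lower letter, `A_l < 0` for an upper letter) and PASSED-DOMINATED for the opposite strict sign.

* ★★★ `eulerNumeratorK_roots_Icc_le_one_of_pivot` — THE PIVOT WINDOW LAW: choose ANY pivot letter `l⋆`.  If on the window every letter whose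
  exponent lies ABOVE `d_{l⋆}` is ahead-dominated and every letter whose exponent lies BELOW `d_{l⋆}` is passed-dominated (letters AT the pivot
  exponent and AT the coupled exponent are unconstrained), and some letter sits off both exponents, then the c-free Euler numerator `R_{l₀}` has
  AT MOST ONE zero in the window.  Mechanism: `x^{−(d_{l⋆} − d_{l₀})}·Σ_j B_j/f_j = Σ_l (d_l − d_{l₀})·A_l(x)·x^{d_l}/x^{d_{l⋆}}` is STRICTLY
  ANTITONE — the pivot term for free (lower: negative coefficient × isotone; upper: positive × antitone), the other terms by the sign hypotheses.
  Instances: pivot = top letter at `K = 3` bottom coupling is `A₁ > 0 ⇒ ≤ 1`; pivot = middle letter is `A₂ < 0 ⇒ ≤ 1`; pivot = bottom letter at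
  the middle coupling is `A₂ < 0 ⇒ ≤ 1`, pivot = top letter is `A₀ < 0 ⇒ ≤ 1`; pivot = the unique lower / upper exponent gives the near-end laws.

HONEST FRAMING: the type-β side of the window bookkeeping for the every-`K`, every-coupling sector of the research stubs `stub_polyLaw` /
`stub_eulerBoundK3` / `stub_oneChangeFloorK3`; the windows with NO admissible pivot (type α) carry the research content and are NOT touched;
closes NO stub by name; NOT `OneChangeFloorK3`, `EulerBoundK3`, `ClassRowK3Linear`, `PPOPolyLaw`, `ProductPlusOneMDR`, `MatrixDescartes`;
`VP ≠ VNP` is NOT proved.  No definitions, no named facts, no sorry.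

[folklore] Elementary monotonicity bookkeeping; no citation needed.
-/

set_option linter.dupNamespace false

namespace Summit.ValiantsHypothesis.ValiantsHypothesis.Theorems.LacunarySymmetroidMatrixDescartes

namespace ProductPlusOne

open Polynomial Finset
open scoped BigOperators

/-- Bookkeeping: a POSITIVE antitone quantity divided by a positive power is strictly antitone:
`0 < A₂ ≤ A₁`… precisely `A₂ ≤ A₁`, `0 < A₁`, `0 < x < y`, `n ≠ 0` ⇒ `A₂/y^n < A₁/x^n`. [folklore] -/
theorem pos_div_pow_strictAnti_aux {A₁ A₂ x y : ℝ} {n : ℕ} (hA : A₂ ≤ A₁) (hA₁ : 0 < A₁) (hx : 0 < x) (hxy : x < y)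
    (hn : n ≠ 0) : A₂ / y ^ n < A₁ / x ^ n := by
  have hxn : 0 < x ^ n := pow_pos hx n
  have hyn : 0 < y ^ n := pow_pos (hx.trans hxy) n
  have hpow : x ^ n < y ^ n := pow_lt_pow_left₀ hxy hx.le hn
  have step1 : A₂ / y ^ n ≤ A₁ / y ^ n := div_le_div_of_nonneg_right hA hyn.le
  have step2 : A₁ / y ^ n < A₁ / x ^ n := by
    have hinv : (y ^ n)⁻¹ < (x ^ n)⁻¹ := (inv_lt_inv₀ hyn hxn).2 hpow
    rw [div_eq_mul_inv, div_eq_mul_inv]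
    exact mul_lt_mul_of_pos_left hinv hA₁
  exact step1.trans_lt step2

/-- ★★★ **THE PIVOT WINDOW LAW** (every `K`, any support, every coupling `l₀`, every pivot `l⋆`).  Split-signed rows; window `[u,v] ⊂ (0,∞)` of
constant row signs; on the window every letter with exponent above `d_{l⋆}` (and off the coupled exponent) is AHEAD-dominated and every letter
with exponent below `d_{l⋆}` (and off the coupled exponent) is PASSED-dominated; some letter sits off both the pivot and the coupled exponent.
Then the c-free Euler numerator `R_{l₀}` has at most one zero in `[u,v]`. [this file's theorem] -/
theorem eulerNumeratorK_roots_Icc_le_one_of_pivot {m K : ℕ} (d : Fin K → ℕ) (a : Fin m → Fin K → ℝ) (l₀ lp : Fin K)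
    (hlow : ∀ j l, d l < d l₀ → 0 ≤ a j l) (hup : ∀ j l, d l₀ < d l → a j l ≤ 0)
    {u v : ℝ} (hu : 0 < u)
    (hsign : ∀ j, (∀ x ∈ Set.Icc u v, 0 < (∑ l, C (a j l) * X ^ (d l) : ℝ[X]).eval x) ∨
      (∀ x ∈ Set.Icc u v, (∑ l, C (a j l) * X ^ (d l) : ℝ[X]).eval x < 0))
    (habove : ∀ x ∈ Set.Icc u v, ∀ l, d lp < d l →
      (d l < d l₀ → 0 < ∑ j, a j l * (x ^ (d l₀) / (∑ l', C (a j l') * X ^ (d l') : ℝ[X]).eval x)) ∧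
      (d l₀ < d l → ∑ j, a j l * (x ^ (d l₀) / (∑ l', C (a j l') * X ^ (d l') : ℝ[X]).eval x) < 0))
    (hbelow : ∀ x ∈ Set.Icc u v, ∀ l, d l < d lp →
      (d l < d l₀ → ∑ j, a j l * (x ^ (d l₀) / (∑ l', C (a j l') * X ^ (d l') : ℝ[X]).eval x) < 0) ∧
      (d l₀ < d l → 0 < ∑ j, a j l * (x ^ (d l₀) / (∑ l', C (a j l') * X ^ (d l') : ℝ[X]).eval x)))
    (hex : ∃ l, d l ≠ d lp ∧ d l ≠ d l₀) :
    ((∑ j, (∑ l, C (a j l * ((d l : ℝ) - d l₀)) * X ^ (d l)) * ∏ i ∈ Finset.univ.erase j, (∑ l, C (a i l) * X ^ (d l))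
        : ℝ[X]).roots.toFinset.filter (fun t => u ≤ t ∧ t ≤ v)).card ≤ 1 := by
  classical
  set f : Fin m → ℝ[X] := fun j => ∑ l, C (a j l) * X ^ (d l) with hf
  set T : Fin m → ℝ → ℝ := fun j x => x ^ (d l₀) / (f j).eval x with hT
  set A : Fin K → ℝ → ℝ := fun l x => ∑ j, a j l * T j x with hAdef
  set Ψ : ℝ → ℝ := fun x => ∑ l, ((d l : ℝ) - d l₀) * (A l x * x ^ (d l) / x ^ (d lp)) with hΨ
  have hpole : ∀ x ∈ Set.Icc u v, ∀ j, (f j).eval x ≠ 0 := by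
    intro x hx j
    rcases hsign j with hs | hs
    · exact (hs x hx).ne'
    · exact (hs x hx).ne
  -- (1) monotonicity of the letter-fraction sums
  have hTmono : ∀ j, MonotoneOn (T j) (Set.Icc u v) := fun j =>
    inv_row_monotone_of_splitSigned d (a j) l₀ (hlow j) (hup j) hu (hsign j)
  have hAlow : ∀ l, d l < d l₀ → MonotoneOn (A l) (Set.Icc u v) := by
    intro l hl x hx y hy hxy
    exact Finset.sum_le_sum fun j _ => mul_le_mul_of_nonneg_left (hTmono j hx hy hxy) (hlow j l hl)
  have hAup : ∀ l, d l₀ < d l → AntitoneOn (A l) (Set.Icc u v) := by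
    intro l hl x hx y hy hxy
    exact Finset.sum_le_sum fun j _ => mul_le_mul_of_nonpos_left (hTmono j hx hy hxy) (hup j l hl)
  -- (2) every term of `Ψ` is antitone; a term off the pivot and off the coupled exponent is strictly antitone
  have hterm : ∀ x ∈ Set.Icc u v, ∀ y ∈ Set.Icc u v, x < y → ∀ l,
      ((d l : ℝ) - d l₀) * (A l y * y ^ (d l) / y ^ (d lp)) ≤ ((d l : ℝ) - d l₀) * (A l x * x ^ (d l) / x ^ (d lp)) ∧
      (d l ≠ d lp → d l ≠ d l₀ →
        ((d l : ℝ) - d l₀) * (A l y * y ^ (d l) / y ^ (d lp)) < ((d l : ℝ) - d l₀) * (A l x * x ^ (d l) / x ^ (d lp))) := by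
    intro x hx y hy hxy l
    have hx0 : 0 < x := hu.trans_le hx.1
    have hy0 : 0 < y := hx0.trans hxy
    -- the ratio `z^{d l}/z^{d lp}` in the three exponent cases
    have hrat_eq : ∀ {z : ℝ}, 0 < z → d l = d lp → A l z * z ^ (d l) / z ^ (d lp) = A l z := by
      intro z hz he; rw [he, mul_div_assoc, div_self (pow_ne_zero _ hz.ne'), mul_one]
    have hrat_gt : ∀ {z : ℝ}, 0 < z → ∀ n, d l = d lp + n → A l z * z ^ (d l) / z ^ (d lp) = A l z * z ^ n := by
      intro z hz n he
      rw [he, pow_add, mul_comm (z ^ d lp) (z ^ n), ← mul_assoc, mul_div_assoc, div_self (pow_ne_zero _ hz.ne'), mul_one]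
    have hrat_lt : ∀ {z : ℝ}, 0 < z → ∀ n, d lp = d l + n → A l z * z ^ (d l) / z ^ (d lp) = A l z / z ^ n := by
      intro z hz n he
      rw [he, pow_add, mul_comm (A l z) (z ^ d l), mul_div_mul_left _ _ (pow_ne_zero _ hz.ne')]
    rcases lt_trichotomy (d l) (d l₀) with hl0 | hl0 | hl0
    · -- LOWER letter: coefficient `c < 0`, `A l` isotone
      have hc : ((d l : ℝ) - d l₀) < 0 := by
        have : (d l : ℝ) < d l₀ := by exact_mod_cast hl0
        linarith
      have hAmono := hAlow l hl0 hx hy hxy.le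
      rcases lt_trichotomy (d l) (d lp) with hlp | hlp | hlp
      · -- below the pivot: passed-dominated, `A l < 0`; `A l / z^n` strictly isotone
        obtain ⟨n, hn⟩ : ∃ n, d lp = d l + n := ⟨d lp - d l, by omega⟩
        have hn0 : n ≠ 0 := by omega
        rw [hrat_lt hx0 n hn, hrat_lt hy0 n hn]
        have hneg : A l x < 0 := (hbelow x hx l hlp).1 hl0
        have hlt : A l x / x ^ n < A l y / y ^ n := neg_div_pow_strictMono_aux hAmono hneg hx0 hxy hn0
        refine ⟨(mul_lt_mul_of_neg_left hlt hc).le, fun _ _ => mul_lt_mul_of_neg_left hlt hc⟩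
      · -- at the pivot exponent: free
        rw [hrat_eq hx0 hlp, hrat_eq hy0 hlp]
        exact ⟨mul_le_mul_of_nonpos_left hAmono hc.le, fun h _ => absurd hlp h⟩
      · -- above the pivot: ahead-dominated, `A l > 0`; `A l · z^n` strictly isotone
        obtain ⟨n, hn⟩ : ∃ n, d l = d lp + n := ⟨d l - d lp, by omega⟩
        have hn0 : n ≠ 0 := by omega
        rw [hrat_gt hx0 n hn, hrat_gt hy0 n hn]
        have hpos : 0 < A l x := (habove x hx l hlp).1 hl0
        have hpow : x ^ n < y ^ n := pow_lt_pow_left₀ hxy hx0.le hn0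
        have hlt : A l x * x ^ n < A l y * y ^ n :=
          calc A l x * x ^ n < A l x * y ^ n := mul_lt_mul_of_pos_left hpow hpos
            _ ≤ A l y * y ^ n := mul_le_mul_of_nonneg_right hAmono (pow_pos hy0 _).le
        refine ⟨(mul_lt_mul_of_neg_left hlt hc).le, fun _ _ => mul_lt_mul_of_neg_left hlt hc⟩
    · -- AT the coupled exponent: coefficient zero
      rw [hl0, sub_self, zero_mul, zero_mul]
      exact ⟨le_rfl, fun _ h => absurd rfl h⟩
    · -- UPPER letter: coefficient `c > 0`, `A l` antitone
      have hc : 0 < ((d l : ℝ) - d l₀) := by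
        have : (d l₀ : ℝ) < d l := by exact_mod_cast hl0
        linarith
      have hAanti := hAup l hl0 hx hy hxy.le
      rcases lt_trichotomy (d l) (d lp) with hlp | hlp | hlp
      · -- below the pivot: passed-dominated, `A l > 0`; `A l / z^n` strictly antitone
        obtain ⟨n, hn⟩ : ∃ n, d lp = d l + n := ⟨d lp - d l, by omega⟩
        have hn0 : n ≠ 0 := by omega
        rw [hrat_lt hx0 n hn, hrat_lt hy0 n hn]
        have hpos : 0 < A l x := (hbelow x hx l hlp).2 hl0
        have hlt : A l y / y ^ n < A l x / x ^ n := pos_div_pow_strictAnti_aux hAanti hpos hx0 hxy hn0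
        refine ⟨(mul_lt_mul_of_pos_left hlt hc).le, fun _ _ => mul_lt_mul_of_pos_left hlt hc⟩
      · rw [hrat_eq hx0 hlp, hrat_eq hy0 hlp]
        exact ⟨mul_le_mul_of_nonneg_left hAanti hc.le, fun h _ => absurd hlp h⟩
      · -- above the pivot: ahead-dominated, `A l < 0`; `A l · z^n` strictly antitone
        obtain ⟨n, hn⟩ : ∃ n, d l = d lp + n := ⟨d l - d lp, by omega⟩
        have hn0 : n ≠ 0 := by omega
        rw [hrat_gt hx0 n hn, hrat_gt hy0 n hn]
        have hneg : A l x < 0 := (habove x hx l hlp).2 hl0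
        have hpow : x ^ n < y ^ n := pow_lt_pow_left₀ hxy hx0.le hn0
        have hlt : A l y * y ^ n < A l x * x ^ n :=
          calc A l y * y ^ n ≤ A l x * y ^ n := mul_le_mul_of_nonneg_right hAanti (pow_pos hy0 _).le
            _ < A l x * x ^ n := mul_lt_mul_of_neg_left hpow hneg
        refine ⟨(mul_lt_mul_of_pos_left hlt hc).le, fun _ _ => mul_lt_mul_of_pos_left hlt hc⟩
  obtain ⟨l₁, hl₁p, hl₁0⟩ := hex
  have hΨanti : ∀ x ∈ Set.Icc u v, ∀ y ∈ Set.Icc u v, x < y → Ψ y < Ψ x := by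
    intro x hx y hy hxy
    simp only [hΨ]
    rw [← Finset.add_sum_erase _ _ (Finset.mem_univ l₁), ← Finset.add_sum_erase _ _ (Finset.mem_univ l₁)]
    exact add_lt_add_of_lt_of_le ((hterm x hx y hy hxy l₁).2 hl₁p hl₁0)
      (Finset.sum_le_sum fun l _ => (hterm x hx y hy hxy l).1)
  -- (3) at a root `t` in the window, `Ψ t = 0`: `Ψ(x) = (Σ_j B_j(x)/f_j(x)) · x^{d l₀} / x^{d lp}`
  have hletter : ∀ x ∈ Set.Icc u v,
      (∑ j, (∑ l, C (a j l * ((d l : ℝ) - d l₀)) * X ^ (d l) : ℝ[X]).eval x / (f j).eval x)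
        = ∑ l, ((d l : ℝ) - d l₀) * ∑ j, a j l * x ^ (d l) / (f j).eval x := by
    intro x hx
    calc (∑ j, (∑ l, C (a j l * ((d l : ℝ) - d l₀)) * X ^ (d l) : ℝ[X]).eval x / (f j).eval x)
        = ∑ j, ∑ l, a j l * ((d l : ℝ) - d l₀) * x ^ (d l) / (f j).eval x := by
          refine Finset.sum_congr rfl fun j _ => ?_
          rw [eulerLetter_eval, Finset.sum_div]
      _ = ∑ l, ∑ j, a j l * ((d l : ℝ) - d l₀) * x ^ (d l) / (f j).eval x := Finset.sum_comm
      _ = ∑ l, ((d l : ℝ) - d l₀) * ∑ j, a j l * x ^ (d l) / (f j).eval x := by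
          refine Finset.sum_congr rfl fun l _ => ?_
          rw [Finset.mul_sum]
          refine Finset.sum_congr rfl fun j _ => ?_
          ring
  have hΨ_eq : ∀ x ∈ Set.Icc u v, Ψ x =
      (∑ j, (∑ l, C (a j l * ((d l : ℝ) - d l₀)) * X ^ (d l) : ℝ[X]).eval x / (f j).eval x) * (x ^ (d l₀) / x ^ (d lp)) := by
    intro x hx
    have hx0 : 0 < x := hu.trans_le hx.1
    rw [hletter x hx, Finset.sum_mul]
    simp only [hΨ, hAdef, hT]
    refine Finset.sum_congr rfl fun l _ => ?_
    rw [mul_assoc ((d l : ℝ) - d l₀) (∑ j, a j l * x ^ (d l) / (f j).eval x) (x ^ (d l₀) / x ^ (d lp))]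
    congr 1
    rw [Finset.sum_mul, Finset.sum_div, Finset.sum_mul]
    refine Finset.sum_congr rfl fun j _ => ?_
    simp only [div_eq_mul_inv]
    ring
  have hroot : ∀ t, t ∈ ((∑ j, (∑ l, C (a j l * ((d l : ℝ) - d l₀)) * X ^ (d l)) *
      ∏ i ∈ Finset.univ.erase j, (∑ l, C (a i l) * X ^ (d l)) : ℝ[X]).roots.toFinset.filter (fun t => u ≤ t ∧ t ≤ v)) → Ψ t = 0 := by
    intro t ht
    rw [Finset.mem_filter, Multiset.mem_toFinset] at ht
    obtain ⟨hrt, htI⟩ := ht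
    have htI' : t ∈ Set.Icc u v := htI
    have hev := (mem_roots (ne_zero_of_mem_roots hrt)).mp hrt
    have hev' := hev
    rw [IsRoot.def, eulerNumeratorK_eval_eq_prod_mul_sum d a l₀ (hpole t htI')] at hev'
    have hP : (∏ i, (∑ l, C (a i l) * X ^ (d l) : ℝ[X]).eval t) ≠ 0 :=
      Finset.prod_ne_zero_iff.mpr fun i _ => hpole t htI' i
    have hsum := (mul_eq_zero.mp hev').resolve_left hP
    rw [hΨ_eq t htI', hsum, zero_mul]
  -- (4) conclude
  rw [Finset.card_le_one]
  intro t₁ ht₁ t₂ ht₂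
  have h1 := hroot t₁ ht₁
  have h2 := hroot t₂ ht₂
  have ht₁I : t₁ ∈ Set.Icc u v := (Finset.mem_filter.mp ht₁).2
  have ht₂I : t₂ ∈ Set.Icc u v := (Finset.mem_filter.mp ht₂).2
  by_contra hne
  rcases lt_or_gt_of_ne hne with hlt | hlt
  · have := hΨanti t₁ ht₁I t₂ ht₂I hlt; linarith
  · have := hΨanti t₂ ht₂I t₁ ht₁I hlt; linarith

end ProductPlusOne

end Summit.ValiantsHypothesis.ValiantsHypothesis.Theorems.LacunarySymmetroidMatrixDescartes
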